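import Literature.NumberTheory.Automorphic.LanglandsTunnellReduction
import Literature.NumberTheory.Automorphic.LanglandsTunnellModThree
import Literature.NumberTheory.GaloisRepresentations.ArtinCharacterReciprocityProofs
import Literature.NumberTheory.Automorphic.TunnellOctahedralGlobalProofs
import Literature.NumberTheory.Automorphic.PiOfArtinRepFrobSatakeCompatibleProofs
import Literature.NumberTheory.Automorphic.GelbartJacquetAdjointLiftArchimedean
import Literature.NumberTheory.GaloisRepresentations.GL2F3Lift
import HarnessLib

/-!
# stub-ideation k2 · generation 14 · `stub_modThree` (S1a) — companion to `STUB-IDEAS-stub_modThree-2.md`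

HOME = FAMILY 2 (RESHAPE).  Contents:

* `SigStubModThree` — the registered stub verbatim (`Lines/Sketch.lean` l.143).
* `stubModThree_of_open_leaves` — PLAN OF RECORD R1 re-checked against today's tree (kernel-checked,
  no `sorry`): the stub from the EIGHT open Langlands–Tunnell leaves (unchanged since gen 11).
* `Cert.*` — kernel certificates (`decide` on the `GL2F3Lift.M2` encoding of the lift
  `Ψ : GL₂(𝔽₃) ↪ GL₂(ℤ[√-2])`) behind the two reshape probes of this generation:
  - **T12 (adjoint road)** `Cert.adChar_eq_ind_epsC`: `Ad⁰Ψ ≅ Ind_{SD₁₆}^{GL₂(𝔽₃)} ε_C`, `ε_C` the sign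
    character of a `2`-Sylow `SD₁₆ = N(C₈)` with kernel the cyclic `C₈` — `Ad⁰σ` of an octahedral `σ` is
    MONOMIAL through Tunnell's own non-normal cubic field `K₃ = Fix(SD₁₆)`; and
    `Cert.order8_traces` / `Cert.order8_square_blind`: the two classes of order `8` (density `1/4`) have
    traces `±√-2`, equal `Ad⁰`-character and conjugate squares — what the adjoint road cannot see.
  - **T13 (dihedral linearisation)** `Cert.tensorChar_eq_ind_mu`: `Ψ ⊗ τ ≅ Ind_B^{GL₂(𝔽₃)}(1 ⊠ sgn)`
    for `τ` the `2`-dimensional representation through `GL₂(𝔽₃)/Q₈ ≅ S₃` (recorded DEAD in the .md).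
* `eq_of_adArch_eq_zero` (PROVED, S) — the exponent half of the archimedean pin of T12 in the exact
  shape of the tree's `GelbartJacquet_adjoint_lift_archimedean`; `pow_three_ne_one_of_sq` (PROVED, S) —
  the odd-rank separation of the two Arthur–Clozel fibres; `wrongDescent_even` (PROVED, S) — the
  parity obstruction: the wrong quadratic-descent class has EVEN central character.
-/

open scoped MatrixGroups NumberField
open Literature.NumberTheory.EllipticCurves
open Literature.NumberTheory.Automorphic
open Literature.NumberTheory.GaloisRepresentations
open WeierstrassCurve

set_option linter.dupNamespace false

namespace Summit.ABC.ABC.Cruxes.FreyModularity.StubModThreeIdeasK2G14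

/-- The registered stub `stub_modThree`, verbatim. -/
def SigStubModThree : Prop :=
  ∀ (W : WeierstrassCurve ℚ) [W.IsElliptic] (ρ : ModPGaloisRep ℚ (ZMod 3) 2),
    W.IsTorsionGaloisRep 3 ρ → FramedRep.IsAbsolutelyIrreducible ρ → ρ.IsModular

/-- **R1 (plan of record, re-checked 2026-09-01 g14).** The stub from the eight open Langlands–Tunnell
leaves; the two discharged leaves (`artinReciprocity_character_holds`,
`exists_twist_quadraticSign_holds`) and the Frobenius/Satake compatibility
(`frobSatakeCompatibleAt_of_isPiOfArtinRep_holds`) are supplied from the tree. -/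
theorem stubModThree_of_open_leaves
    (hAI : automorphicInduction_character)
    (hdesc3 : exists_cuspidal_descent_det_cubic) (hGJ : GelbartJacquet_adjoint_lift)
    (hJS : JacquetShalika_eq_of_rsData_eq) (hdesc : cuspidal_descent_cyclic)
    (ha : ArthurClozel_fibres_quadratic) (hb : tunnell_cuspidal_cubic_lifts)
    (hW1 : exists_isNewform1_of_isPiOfArtinRep) : SigStubModThree :=
  fun W _ ρ hρ habs ↦
    W.isModular_of_isTorsionGaloisRep_three_of_langlands_tunnell
      (langlands_tunnell_of_leaves artinReciprocity_character_holds hAI hdesc3 hGJ hJS hdesc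
        exists_twist_quadraticSign_holds ha hb frobSatakeCompatibleAt_of_isPiOfArtinRep_holds hW1)
      ρ hρ habs

/-! ## Kernel certificates on the `M2` encoding of `Ψ(GL₂(𝔽₃)) ⊂ GL₂(ℤ[√-2])` -/

namespace Cert

open GL2F3Lift GL2F3Lift.M2

/-- Trace on the encoding: `χ_Ψ(g) = tr Ψ(g) ∈ ℤ[√-2]`. -/
def trM (x : M2) : ℤ√(-2) := x.a + x.d

/-- `χ_{Ad⁰Ψ}(g) = χ_Ψ(g) χ_Ψ(g⁻¹) - 1 = tr(g)² det(g) - 1` (`det = ±1`, `tr(g⁻¹) = tr(g)/det(g)`). -/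
def adChar (x : M2) : ℤ√(-2) := trM x * trM x * det x - 1

/-- Powers of the order-`8` generator `β̃ = genB` (`det β̃ = -1`, `tr β̃ = √-2`). -/
def powB : ℕ → M2
  | 0 => one
  | n + 1 => mul genB (powB n)

/-- The cyclic group `C₈ = ⟨β̃⟩`. -/
def C8 : List M2 := (List.range 8).map powB

/-- `H = N_G(C₈)`, a `2`-Sylow subgroup `SD₁₆` of `GL₂(𝔽₃)` (lifted): the `x` with `x β̃ x^{adj} ∈ C₈`
(`x^{adj} = ± x⁻¹` and `-1 ∈ C₈`, so the test is conjugation-invariance of `C₈`). -/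
def H16 : List M2 := elems.filter fun x => mul (mul x genB) (adj x) ∈ C8

/-- `ε_C` extended by zero: `+1` on `C₈`, `-1` on `H ∖ C₈`, `0` off `H`. -/
def epsDot (y : M2) : ℤ√(-2) := if y ∈ C8 then 1 else if y ∈ H16 then -1 else 0

/-- `β̃⁸ = 1`, `β̃⁴ = -1`. -/
theorem powB_eight_and_four : powB 8 = one ∧ powB 4 = negOne := by decide

/-- `C₈` has `8` distinct elements, all in `S`, and is closed under multiplication. -/
theorem C8_cert : C8.length = 8 ∧ C8.Nodup ∧ (∀ x ∈ C8, x ∈ elems) ∧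
    ∀ x ∈ C8, ∀ y ∈ C8, mul x y ∈ C8 := by decide

/-- `H` is a subgroup of order `16` containing `C₈` (so `H ≅ SD₁₆`, index `3`). -/
theorem H16_cert : H16.length = 16 ∧ one ∈ H16 ∧ (∀ x ∈ C8, x ∈ H16) ∧
    ∀ x ∈ H16, ∀ y ∈ H16, mul x y ∈ H16 := by decide

/-- `ε_C` is a character of `H` (multiplicative on `H`, values `±1`). -/
theorem epsDot_mul : ∀ x ∈ H16, ∀ y ∈ H16, epsDot (mul x y) = epsDot x * epsDot y := by decide

/-- `α̃ ∉ H`: `{1, α̃, α̃²}` is a left transversal of `H` in `G` (`α̃` has order `3`, `[G:H] = 3`). -/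
theorem genA_not_mem_H16 : genA ∉ H16 ∧ genAinv ∉ H16 ∧ mul genA genAinv = one := by decide

/-- **T12 certificate.** Frobenius' formula with the transversal `{1, α̃, α̃⁻¹}`:
`χ_{Ad⁰Ψ}(g) = ε̇_C(g) + ε̇_C(α̃⁻¹ g α̃) + ε̇_C(α̃ g α̃⁻¹) = (Ind_H^G ε_C)(g)` for all `48` elements —
`Ad⁰Ψ ≅ Ind_{SD₁₆}^{GL₂(𝔽₃)} ε_C` is monomial from the non-normal index-`3` subgroup. -/
theorem adChar_eq_ind_epsC : ∀ g ∈ elems,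
    adChar g = epsDot g + epsDot (mul (mul genAinv g) genA) + epsDot (mul (mul genA g) genAinv) := by
  decide

/-- The value table of `χ_{Ad⁰Ψ}`: `3` on `±1`, `-1` on order `4` and on reflections, `0` on orders
`3, 6`, `1` on order `8`. -/
theorem adChar_values : ∀ g ∈ elems, adChar g = 3 ∨ adChar g = -1 ∨ adChar g = 0 ∨ adChar g = 1 := by
  decide

/-- **What `Ad` cannot see.** The elements of determinant `-1` and non-zero trace (the two classes of
order `8`, `12` elements, Frobenius density `1/4`) have traces `±√-2`, BOTH signs occur, and
`χ_{Ad⁰Ψ} = 1` on all of them. -/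
theorem order8_traces : (∀ g ∈ elems, det g = -1 → trM g ≠ 0 →
      (trM g = Zsqrtd.sqrtd ∨ trM g = -Zsqrtd.sqrtd) ∧ adChar g = 1) ∧
    (∃ g ∈ elems, det g = -1 ∧ trM g = Zsqrtd.sqrtd) ∧
    (∃ g ∈ elems, det g = -1 ∧ trM g = -Zsqrtd.sqrtd) := by
  decide

/-- … and their squares all lie in the single class of order `4` (trace `0`, fourth power `-1`): no
even tensor operation separates `8a` from `8b`; only `σ ↦ σ ⊗ ω_E` swaps them. -/
theorem order8_square_blind : ∀ g ∈ elems, det g = -1 → trM g ≠ 0 →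
    trM (mul g g) = 0 ∧ mul (mul g g) (mul g g) = negOne := by
  decide

/-! ### T13: `Ψ ⊗ τ` is a principal series of `GL₂(𝔽₃)` -/

/-- `χ_τ` for `τ` = the standard `2`-dimensional representation of `S₃ ≅ GL₂(𝔽₃)/Q₈` pulled back:
`2` on `Q₈`, `0` on `det = -1` (transpositions; `sgn_{S₃}` pulls back to `det`), `-1` otherwise. -/
def tauChar (x : M2) : ℤ√(-2) := if x ∈ elemsQ then 2 else if det x = -1 then 0 else -1

/-- The Borel subgroup (upper triangular mod `𝔭 = (1 + √-2)`), lifted. -/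
def B12 : List M2 := elems.filter fun x => red x.c = 0

/-- `μ = 1 ⊠ sgn` on `B` (`sgn (d mod 𝔭)`), extended by zero. -/
def muDot (y : M2) : ℤ√(-2) := if y ∈ B12 then (if red y.d = 1 then 1 else -1) else 0

/-- The lift in `elemsSL` of a given residue mod `𝔭` (default `1`). -/
def liftSL (r : ZMod 3 × ZMod 3 × ZMod 3 × ZMod 3) : M2 :=
  (elemsSL.find? fun x => redM x = r).getD one

/-- Left transversal of `B` in `G`: lifts of `1, (0 -1; 1 0), (1 0; 1 1), (1 0; -1 1)` (the four
points of `ℙ¹(𝔽₃)`), all of determinant `1` so that `adj = ⁻¹` exactly. -/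
def T4 : List M2 := [one, liftSL (0, 2, 1, 0), liftSL (1, 0, 1, 1), liftSL (1, 0, 2, 1)]

/-- `B` is a subgroup of order `12`; `μ` is a character of `B`; `T4 ⊂ SL` is a left transversal. -/
theorem B12_cert : B12.length = 12 ∧ one ∈ B12 ∧ (∀ x ∈ B12, ∀ y ∈ B12, mul x y ∈ B12) ∧
    (∀ x ∈ B12, ∀ y ∈ B12, muDot (mul x y) = muDot x * muDot y) ∧
    (∀ t ∈ T4, t ∈ elemsSL) ∧ (∀ t ∈ T4, ∀ t' ∈ T4, t ≠ t' → mul (adj t) t' ∉ B12) := by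
  decide

/-- **T13 certificate.** `χ_Ψ · χ_τ = Ind_B^G (1 ⊠ sgn)` on all `48` elements (Frobenius' formula with
the transversal `T4`): `Ψ ⊗ τ` is the principal series `Ind_B^G(1 ⊠ sgn)`, i.e. `σ ⊗ τ = Ind_{K₄}^ℚ ε₄`
is monomial from the quartic `3`-isogeny field. -/
theorem tensorChar_eq_ind_mu : ∀ g ∈ elems,
    trM g * tauChar g = (T4.map fun t => muDot (mul (mul (adj t) g) t)).sum := by
  decide

end Cert

/-! ## Small helpers of the adjoint road (T12), typed against the tree -/

/-- **H3a (PROVED, S) — exponent half of the archimedean pin.** In the exact shape of the archimedean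
clause of `GelbartJacquet_adjoint_lift_archimedean` (`χ ↦ ((χ ×ˢ χ).map (p ↦ p.1 - p.2)).erase 0`):
if the adjoint lift of a `π_∞` with exponents `{a, b}` has the parameter `{0, 0, 0}` of
`Π₃,∞ = sgn ⊞ π(1, sgn)`, then `a = b`.  (The SIGN half — `μ₁/μ₂ = sgn`, equivalently the parity of
`ω_π` — is invisible to `HasArchParameter`; see the .md, §2 T12 verdict.) -/
theorem eq_of_adArch_eq_zero (a b : ℂ)
    (h : ((({a, b} : Multiset ℂ) ×ˢ ({a, b} : Multiset ℂ)).map (fun p => p.1 - p.2)).erase 0 =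
      {0, 0, 0}) : a = b := by
  by_contra hab
  have hne : a - b ≠ 0 := sub_ne_zero.mpr hab
  have hmem : a - b ∈ ((({a, b} : Multiset ℂ) ×ˢ ({a, b} : Multiset ℂ)).map
      (fun p => p.1 - p.2)).erase 0 := by
    rw [Multiset.mem_erase_of_ne hne, Multiset.mem_map]
    exact ⟨(a, b), Multiset.mem_product.mpr ⟨by simp, by simp⟩, rfl⟩
  rw [h] at hmem
  simp only [Multiset.insert_eq_cons, Multiset.mem_cons, Multiset.mem_singleton, or_self] at hmem
  exact hne hmem

/-- **H2 (PROVED, S) — odd rank separates the Arthur–Clozel fibres.** A quadratic character `ω`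
(`ω² = 1`, `ω ≠ 1`) has `ω³ ≠ 1`: for `Π₃` on `GL₃` the two candidates `Π₃`, `Π₃ ⊗ ω_E` of a quadratic
descent have DIFFERENT central characters (`ω ↦ ω · ω_E³ = ω · ω_E`), unlike rank `2`. -/
theorem pow_three_ne_one_of_sq {M : Type*} [Monoid M] {ω : M} (h2 : ω ^ 2 = 1) (h1 : ω ≠ 1) :
    ω ^ 3 ≠ 1 := by
  rwa [pow_succ, h2, one_mul]

/-- **H4 (PROVED, S) — the parity obstruction.** If `det σ(c) = -1` (odd) and `ω_E(c) = -1`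
(`E = ℚ(√-3)` imaginary), the wrong descent class `ω_π = det σ · ω_E` is EVEN at `c`: the parity bit
`η = ω_π / det σ ∈ {1, ω_E}` is exactly the weight-one sign, and no exponent-level archimedean
statement decides it. -/
theorem wrongDescent_even {R : Type*} [Monoid R] [HasDistribNeg R] {d e : R} (hd : d = -1)
    (he : e = -1) : d * e = 1 := by
  subst hd; subst he; rw [neg_one_mul, neg_neg]

end Summit.ABC.ABC.Cruxes.FreyModularity.StubModThreeIdeasK2G14
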